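import Literature.Computability.AlgebraicComplexity.BI17Example37Proofs
import Literature.Computability.AlgebraicComplexity.BI17DegreeExponentMonoidProofs
import Literature.Computability.AlgebraicComplexity.BI17GenericBinaryFormStabilizerProofs
import HarnessLib

/-!
# Bürgisser–Ikenmeyer 2017, App. Prop. 7.4 (2): the generic binary quartic has stabilizer period
# `a(4,2) = 2` and reduced period `a'(4,2) = 1` — proofs

Theorem-only companion (cell `val-lit`, row BI2017-A; no definitions, no named facts) of
`BI17FundamentalInvariantForms.lean` (named fact `BI2017_prop_A_4`). P. Bürgisser, C. Ikenmeyer,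
*Fundamental invariants of orbit closures*, J. Algebra 477 (2017), Appendix Prop. 7.4 (2)
(main.tex L2929–2931): "2. For a generic `w ∈ Sym⁴ℂ²` we have `stab(w) ≃ C_2 × C_2`. Hence
`a(4,2) = 2` and `a'(4,2) = 1`." The typed clause —
`IsZariskiGeneric 4 (fun f => stabilizerPeriod f = 2 ∧ reducedStabilizerPeriod 4 f = 1)` — is
PROVED here (`BI2017_prop_A_4_part2`); with `BI2017_prop_A_4_part3` (sibling file) the named fact is
reduced to its first clause (binary cubics, `a(3,2) = 6`), `BI2017_prop_A_4_of_part1`.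

## Proof (invariant degrees; the group isomorphism of the print is not used)

* Binary quartics have nonzero `SL_2`-invariants of degrees `2` and `3` (the classical `I`, `J`),
  obtained here by COUNTING: `dim O(Sym⁴ℂ²)^{SL_2}_d = a_{(2d,2d)}(d[4])`
  (`finrank_slInvariantsOfDegree_eq_plethysmCoeff`, val-lit-p4) and Cayley–Sylvester
  (`plethysmCoeff_rowDual_three_add`, val-lit-p6 g2: `a_{(L,b,0)}(d[n]) = p_b(d,n) − p_{b-1}(d,n)`),
  the box partition counts `p_4(2,4) − p_3(2,4) = 3 − 2` and `p_6(3,4) − p_5(3,4) = 5 − 4` being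
  kernel evaluations (`boxPartitionCount_eq_boxCount`).
* An `SL_2`-invariant `F` of degree `d` satisfies `F(g · p) = det(g)^{4d/2} F(p)`
  (`IsSLInvariantCoord.aeval_formCoeff_linSubstRep_eq_det_pow`, val-lit-t04); so for `g ∈ stab(p)`
  with `I(p) J(p) ≠ 0`: `det(g)^4 = det(g)^6 = 1`, i.e. `det(g)^2 = 1`, while `det(i · 1) = -1`
  (`i · 1 ∈ stab(p)` as `i^4 = 1`). Hence `det(stab p) = {±1}`, `a(p) = 2`, and
  `a'(p) = a(p) · gcd(4,2) / 4 = 1`; the genericity polynomial is `I · J`.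

Honest framing: bookkeeping of a printed statement on binary quartics; nothing here bears on VP
versus VNP.

## References

* [BurgisserIkenmeyer2017] P. Bürgisser, C. Ikenmeyer, J. Algebra 477 (2017) 390–434 =
  arXiv:1511.02927, Appendix Prop. 7.4 (2) (main.tex L2925–2934); §2.1 Def. 2.2; Lemma 3.2 (1).

## Tree

`slInvariantsOfDegree`, `mem_slInvariantsOfDegree_iff`, `stabilizerDetImage`,
`mem_stabilizerDetImage_iff`, `stabilizerPeriod`, `reducedStabilizerPeriod`, `IsZariskiGeneric`,
`BI2017_prop_A_4` (`BI17FundamentalInvariantForms`); `finrank_slInvariantsOfDegree_eq_plethysmCoeff`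
(`BI17InvariantsRectangularHighestWeight`); `plethysmCoeff_rowDual_two_eq_three`,
`plethysmCoeff_rowDual_three_add` (`BLMW11SylvesterPlethysmProofs`); `boxPartitionCount_eq_boxCount`
(`DIP20MultiplicityObstructions`); `IsSLInvariantCoord.aeval_formCoeff_linSubstRep_eq_det_pow`
(`BI17DegreeExponentMonoidProofs`); `linSubst_smul_one_fin_two`, `BI2017_prop_A_4_part3`
(`BI17GenericBinaryFormStabilizerProofs`). Mathlib: `Nat.card_zpowers`, `orderOf_eq_prime`,
`sq_eq_one_iff`, `pow_gcd_eq_one`, `Matrix.GeneralLinearGroup.mkOfDetNeZero`.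
-/

noncomputable section

open MvPolynomial
open scoped BigOperators

namespace Literature.Computability.AlgebraicComplexity

open _root_.Literature.NumberTheory.DiophantineGeometry

/-! ### §1 Invariants of binary quartics of degrees 2 and 3 exist (by counting) -/

section Invariants

/-- `dim O(Sym⁴ℂ²)^{SL_2}_2 = 1` (the invariant `I`): `a_{(4,4)}(2[4]) = p_4(2,4) − p_3(2,4) = 3 − 2`
by Cayley–Sylvester. [cite: BurgisserIkenmeyer2017, §7 (Appendix) Prop. 7.4 (2)] -/
theorem finrank_slInvariantsOfDegree_binaryQuartic_two :
    Module.finrank ℂ (slInvariantsOfDegree (Fin 2) ℂ 4 2) = 1 := by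
  have hfin := finrank_slInvariantsOfDegree_eq_plethysmCoeff (m := 2) (D := 4) (d := 2)
    (by norm_num) (by norm_num) ⟨4, by norm_num⟩
  have hrow : (fun _ : Fin 2 => -((4 * 2 / 2 : ℕ) : ℤ)) = rowDual ![4, 4] := by
    funext i
    fin_cases i <;> simp [rowDual, Weight.dual]
  rw [hfin, hrow, plethysmCoeff_rowDual_two_eq_three 4 4 4 le_rfl]
  have h := plethysmCoeff_rowDual_three_add 4 2 4 4 (by norm_num) le_rfl (by norm_num)
  rw [if_pos (by norm_num : 1 ≤ 4), boxPartitionCount_eq_boxCount, boxPartitionCount_eq_boxCount] at h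
  have h3 : boxCount (4 - 1) 2 4 = 2 := by decide
  have h4 : boxCount 4 2 4 = 3 := by decide
  rw [h3, h4] at h
  omega

/-- `dim O(Sym⁴ℂ²)^{SL_2}_3 = 1` (the invariant `J`): `a_{(6,6)}(3[4]) = p_6(3,4) − p_5(3,4) = 5 − 4`
by Cayley–Sylvester. [cite: BurgisserIkenmeyer2017, §7 (Appendix) Prop. 7.4 (2)] -/
theorem finrank_slInvariantsOfDegree_binaryQuartic_three :
    Module.finrank ℂ (slInvariantsOfDegree (Fin 2) ℂ 4 3) = 1 := by
  have hfin := finrank_slInvariantsOfDegree_eq_plethysmCoeff (m := 2) (D := 4) (d := 3)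
    (by norm_num) (by norm_num) ⟨6, by norm_num⟩
  have hrow : (fun _ : Fin 2 => -((4 * 3 / 2 : ℕ) : ℤ)) = rowDual ![6, 6] := by
    funext i
    fin_cases i <;> simp [rowDual, Weight.dual]
  rw [hfin, hrow, plethysmCoeff_rowDual_two_eq_three 4 6 6 le_rfl]
  have h := plethysmCoeff_rowDual_three_add 4 3 6 6 (by norm_num) le_rfl (by norm_num)
  rw [if_pos (by norm_num : 1 ≤ 6), boxPartitionCount_eq_boxCount, boxPartitionCount_eq_boxCount] at h
  have h5 : boxCount (6 - 1) 3 4 = 4 := by decide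
  have h6 : boxCount 6 3 4 = 5 := by decide
  rw [h5, h6] at h
  omega

/-- A one-dimensional space of invariants contains a nonzero homogeneous `SL`-invariant.
[cite: BurgisserIkenmeyer2017, §3 (Def. 3.3)] -/
theorem exists_ne_zero_of_finrank_slInvariantsOfDegree_eq_one {m D d : ℕ}
    (h : Module.finrank ℂ (slInvariantsOfDegree (Fin m) ℂ D d) = 1) :
    ∃ F : MvPolynomial (DegIdx (Fin m) D) ℂ, F ≠ 0 ∧ F.IsHomogeneous d ∧ IsSLInvariantCoord D F := by
  haveI : Module.Finite ℂ (slInvariantsOfDegree (Fin m) ℂ D d) :=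
    Module.finite_of_finrank_pos (by rw [h]; exact one_pos)
  obtain ⟨⟨F, hF⟩, hF0⟩ := (Module.finrank_pos_iff_exists_ne_zero (R := ℂ)
    (M := slInvariantsOfDegree (Fin m) ℂ D d)).mp (by rw [h]; exact one_pos)
  obtain ⟨hFh, hFi⟩ := (mem_slInvariantsOfDegree_iff D d F).mp hF
  exact ⟨F, fun h0 => hF0 (Subtype.ext h0), hFh, hFi⟩

end Invariants

/-! ### §2 The stabilizer period of a quartic with `I J ≠ 0` -/

section Period

/-- **`det(g)^2 = 1` on the stabilizer of a binary quartic at which the invariants of degrees `2` and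
`3` do not vanish**: `F(g · p) = det(g)^{4d/2} F(p)` (BI Lemma 3.2 (1)) gives `det(g)^4 = det(g)^6 = 1`.
[cite: BurgisserIkenmeyer2017, §7 (Appendix) Prop. 7.4 (2)] -/
theorem det_sq_eq_one_of_mem_linStabilizer_quartic {p : MvPolynomial (Fin 2) ℂ}
    (hp : p.IsHomogeneous 4) {I J : MvPolynomial (DegIdx (Fin 2) 4) ℂ}
    (hIh : I.IsHomogeneous 2) (hIi : IsSLInvariantCoord 4 I) (hJh : J.IsHomogeneous 3)
    (hJi : IsSLInvariantCoord 4 J) (hIp : aeval (formCoeff 4 p) I ≠ 0)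
    (hJp : aeval (formCoeff 4 p) J ≠ 0) {g : GL (Fin 2) ℂ} (hg : g ∈ linStabilizer p) :
    ((Matrix.GeneralLinearGroup.det g : ℂˣ) : ℂ) ^ 2 = 1 := by
  rw [mem_linStabilizer] at hg
  have h4 : ((Matrix.GeneralLinearGroup.det g : ℂˣ) : ℂ) ^ 4 = 1 := by
    have h := hIi.aeval_formCoeff_linSubstRep_eq_det_pow (by norm_num : 0 < 2) hp hIh
      (n := 4) (by norm_num) g
    rw [hg] at h
    exact ((mul_eq_right₀ hIp).mp h.symm)
  have h6 : ((Matrix.GeneralLinearGroup.det g : ℂˣ) : ℂ) ^ 6 = 1 := by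
    have h := hJi.aeval_formCoeff_linSubstRep_eq_det_pow (by norm_num : 0 < 2) hp hJh
      (n := 6) (by norm_num) g
    rw [hg] at h
    exact ((mul_eq_right₀ hJp).mp h.symm)
  have h2 : ((Matrix.GeneralLinearGroup.det g : ℂˣ) : ℂ) ^ Nat.gcd 4 6 = 1 :=
    pow_gcd_eq_one.mpr ⟨h4, h6⟩
  rwa [show Nat.gcd 4 6 = 2 by decide] at h2

/-- **The stabilizer period of a binary quartic with `I(p) J(p) ≠ 0` is `a(p) = 2`**:
`det(stab p) = {±1}` (`det(g)² = 1`, and `det(i · 1) = -1` with `i · 1 ∈ stab(p)`).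
[cite: BurgisserIkenmeyer2017, §7 (Appendix) Prop. 7.4 (2)] -/
theorem stabilizerPeriod_eq_two_of_quartic {p : MvPolynomial (Fin 2) ℂ}
    (hp : p.IsHomogeneous 4) {I J : MvPolynomial (DegIdx (Fin 2) 4) ℂ}
    (hIh : I.IsHomogeneous 2) (hIi : IsSLInvariantCoord 4 I) (hJh : J.IsHomogeneous 3)
    (hJi : IsSLInvariantCoord 4 J) (hIp : aeval (formCoeff 4 p) I ≠ 0)
    (hJp : aeval (formCoeff 4 p) J ≠ 0) : stabilizerPeriod p = 2 := by
  classical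
  -- the scalar stabilizer element `i · 1`, of determinant `-1`
  have hdet : Matrix.det (Complex.I • (1 : Matrix (Fin 2) (Fin 2) ℂ)) = -1 := by
    rw [Matrix.det_smul, Matrix.det_one, mul_one, Fintype.card_fin, Complex.I_sq]
  have hdet0 : Matrix.det (Complex.I • (1 : Matrix (Fin 2) (Fin 2) ℂ)) ≠ 0 := by
    rw [hdet]; norm_num
  let γ₀ : GL (Fin 2) ℂ := Matrix.GeneralLinearGroup.mkOfDetNeZero _ hdet0
  have hγ₀ : γ₀ ∈ linStabilizer p := by
    rw [mem_linStabilizer, linSubstRep_apply]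
    change linSubst (Fin 2) ℂ (Complex.I • (1 : Matrix (Fin 2) (Fin 2) ℂ)) p = p
    rw [linSubst_smul_one_fin_two hp, show Complex.I ^ 4 = 1 by
      rw [show (4 : ℕ) = 2 * 2 by norm_num, pow_mul, Complex.I_sq]; norm_num, one_smul]
  set u₀ : ℂˣ := Matrix.GeneralLinearGroup.det γ₀ with hu₀
  have hu₀val : (u₀ : ℂ) = -1 := by
    rw [hu₀, Matrix.GeneralLinearGroup.val_det_apply]
    exact hdet
  have hu₀mem : u₀ ∈ stabilizerDetImage p :=
    (mem_stabilizerDetImage_iff p u₀).mpr ⟨γ₀, hγ₀, rfl⟩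
  -- `det(stab p) = ⟨u₀⟩`
  have hH : stabilizerDetImage p = Subgroup.zpowers u₀ := by
    refine le_antisymm ?_ ((Subgroup.zpowers_le).mpr hu₀mem)
    intro u hu
    obtain ⟨g, hg, rfl⟩ := (mem_stabilizerDetImage_iff p u).mp hu
    have h2 := det_sq_eq_one_of_mem_linStabilizer_quartic hp hIh hIi hJh hJi hIp hJp hg
    rcases sq_eq_one_iff.mp h2 with h1 | h1
    · have : Matrix.GeneralLinearGroup.det g = 1 := Units.ext h1
      rw [this]
      exact one_mem _
    · have : Matrix.GeneralLinearGroup.det g = u₀ := Units.ext (by rw [h1, hu₀val])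
      rw [this]
      exact Subgroup.mem_zpowers u₀
  have hord : orderOf u₀ = 2 := by
    haveI : Fact (Nat.Prime 2) := ⟨Nat.prime_two⟩
    refine orderOf_eq_prime ?_ ?_
    · apply Units.ext
      rw [Units.val_pow_eq_pow_val, hu₀val, Units.val_one]
      norm_num
    · intro h
      have := congrArg (fun u : ℂˣ => (u : ℂ)) h
      simp only [hu₀val, Units.val_one] at this
      norm_num at this
  rw [stabilizerPeriod, hH, Nat.card_zpowers, hord]

end Period

/-! ### §3 BI 2017 App. Prop. 7.4 (2), and the named fact reduced to its first clause -/

section Main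

/-- **BI 2017, Appendix Prop. 7.4 (2), PROVED** (main.tex L2929–2931): "For a generic `w ∈ Sym⁴ℂ²`
… `a(4,2) = 2` and `a'(4,2) = 1`": for Zariski-generic binary quartics `p` (off `{I J = 0}`),
`stabilizerPeriod p = 2` and `reducedStabilizerPeriod 4 p = 1`. The printed group isomorphism
`stab(w) ≃ C_2 × C_2` (modulo scalars) is not typed and not used.
[cite: BurgisserIkenmeyer2017, §7 (Appendix) Prop. 7.4 (2)] -/
theorem BI2017_prop_A_4_part2 :
    IsZariskiGeneric 4 (fun f : MvPolynomial (Fin 2) ℂ =>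
      stabilizerPeriod f = 2 ∧ reducedStabilizerPeriod 4 f = 1) := by
  obtain ⟨I, hI0, hIh, hIi⟩ :=
    exists_ne_zero_of_finrank_slInvariantsOfDegree_eq_one finrank_slInvariantsOfDegree_binaryQuartic_two
  obtain ⟨J, hJ0, hJh, hJi⟩ :=
    exists_ne_zero_of_finrank_slInvariantsOfDegree_eq_one
      finrank_slInvariantsOfDegree_binaryQuartic_three
  refine ⟨I * J, mul_ne_zero hI0 hJ0, fun f hf hIJ => ?_⟩
  rw [map_mul] at hIJ
  have hIp : aeval (formCoeff 4 f) I ≠ 0 := left_ne_zero_of_mul hIJ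
  have hJp : aeval (formCoeff 4 f) J ≠ 0 := right_ne_zero_of_mul hIJ
  have hper := stabilizerPeriod_eq_two_of_quartic hf hIh hIi hJh hJi hIp hJp
  refine ⟨hper, ?_⟩
  rw [reducedStabilizerPeriod, hper, Fintype.card_fin]
  decide

/-- **The named fact `BI2017_prop_A_4` reduced to its first clause** (binary cubics: generically
`a(3,2) = 6`, `a'(3,2) = 2`): clauses 2 and 3 are the tree's `BI2017_prop_A_4_part2` and
`BI2017_prop_A_4_part3`. [cite: BurgisserIkenmeyer2017, §7 (Appendix) Prop. 7.4] -/
theorem BI2017_prop_A_4_of_part1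
    (h1 : IsZariskiGeneric 3 (fun f : MvPolynomial (Fin 2) ℂ =>
      stabilizerPeriod f = 6 ∧ reducedStabilizerPeriod 3 f = 2)) : BI2017_prop_A_4 :=
  ⟨h1, BI2017_prop_A_4_part2, BI2017_prop_A_4_part3⟩

end Main

end Literature.Computability.AlgebraicComplexity
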